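import Summits.AtomisticToContinuum.FouriersLaw.Theorems.BondHeatUncertaintyExtensiveSnapshotIrreversibilityEnergyWindowDivergenceHalfExp
import Summits.AtomisticToContinuum.FouriersLaw.Theorems.BondHeatUncertaintyExtensiveSnapshotIrreversibilityEnergyWindowAtomsExpMoment

/-!
# Crux `ExtensiveSnapshotIrreversibility` (stmt-AtomisticToContinuum-9121), fixed-`N` half `K_fix`:
the DIVERGENCE LADDER — the tail atom SPC from window smallness (node «DivergenceLadder», 6/6)

(statement + glue file, theorem-side; decomp-a2c lens-1 «grading / quantitative ladder», gen 89.)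

The tail atom SPC `NessOddLogRatioConcentration` of `…EnergyWindowDivergenceAtoms` (superpolynomial
concentration IN PROBABILITY of the odd log-ratio `ψ_δ = φ_δ − φ_δ∘Θ` under the steady state) is
graded against the energy window of the record line (70W–88M):

* `NessOddLogRatioWindowSmall` (LWS) — on every logarithmic energy window `{H ≤ s·log(1/|δ|)}`
  the odd log-ratio is eventually UNIFORMLY SMALL: `|ψ_δ| ≤ η` `μ_T`-a.e. there, for
  `0 < |δ| < δ₀(η, s)`.  No rate, no polynomial envelope, nothing off the window (two-sided, but
  qualitative; any pointwise bound `|ψ_δ| ≤ C|δ|^κ (1+H)^m` with `κ > 0` gives it);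
* ★ `nessOddLogRatioConcentration_of_windowSmall` — **A1 ∧ LWS ⟹ SPC**: off the window the steady
  state has mass `μ_δ(H > s' log(1/|δ|)) ≤ C₁ |δ|^{θ s'}` by the uniform exponential moment A1
  (`NessExpMomentBound`, a tree theorem `nessExpMomentBound_holds`) and Chebyshev; choosing
  `θ s' = s + 1` makes it `≤ |δ|ˢ` for `|δ| < 1/(C₁⁺ + 1)`;
* `nessOddLogRatioConcentration_of_windowSmall'` — the same with A1 discharged;
* `snapshotKLUpperExpansion_of_ladder` — the ladder-internal junction
  **`K_fix ⟸ A0 ∧ A2ₚ ∧ LWS ∧ QMD₀`** (`p > 1`; A1 discharged), and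
  `snapshotKLUpperExpansion_of_ladder₄` with A4 in place of QMD₀.

No new objects. [folklore]
-/

noncomputable section

namespace Summit.AtomisticToContinuum.FouriersLaw.Theorems.ExtensiveSnapshotIrreversibility.EnergyWindow

open MeasureTheory Filter Topology InformationTheory Real
open scoped ENNReal NNReal
open Literature.MathematicalPhysics.KineticTheory.HeatConduction
open Summit.AtomisticToContinuum.FouriersLaw.Theorems.ExtensiveSnapshotIrreversibility.Negative
open Summit.AtomisticToContinuum.FouriersLaw.Theorems.ExtensiveSnapshotIrreversibility.ClausiusBudget.OddLogDensity

variable {N : ℕ}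

/-! ## 1. The window-smallness atom LWS -/

/-- **LWS `NessOddLogRatioWindowSmall` (the odd log-ratio is eventually small on logarithmic energy
windows)**: along every steady-state family (under weak-NESS uniqueness), for `T > 0`, `N ≥ 2`,
every level `η > 0` and every window slope `s`, there is `δ₀ > 0` such that for `0 < |δ| < δ₀` and
EVERY measurable `φ` with `μ_{N,T+δ/2,T−δ/2} = μ_T · e^{φ}`: `|φ(x) − φ(Θx)| ≤ η` for `μ_T`-a.e. `x`
with `H(x) ≤ s · log(1/|δ|)`. [route statement · this cell; NOT a literature fact] -/
def NessOddLogRatioWindowSmall : Prop :=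
  ∀ ω₂ lam β γ : ℝ, 0 < ω₂ → 0 < lam → 0 < β → 0 < γ →
    (∀ (N : ℕ) (T_L T_R : ℝ), 0 < T_L → 0 < T_R → ∀ μ ν : Measure (PhaseSpace N),
      (pinnedChain ω₂ lam β γ).IsSteadyState N T_L T_R μ →
      (pinnedChain ω₂ lam β γ).IsSteadyState N T_L T_R ν → μ = ν) →
    ∀ μ : (N : ℕ) → ℝ → ℝ → Measure (PhaseSpace N),
      (∀ (N : ℕ) (T_L T_R : ℝ), 0 < T_L → 0 < T_R →
        (pinnedChain ω₂ lam β γ).IsSteadyState N T_L T_R (μ N T_L T_R)) →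
      ∀ T : ℝ, 0 < T → ∀ N : ℕ, 2 ≤ N → ∀ η : ℝ, 0 < η → ∀ s : ℝ,
        ∃ δ₀ : ℝ, 0 < δ₀ ∧
          ∀ δ : ℝ, δ ≠ 0 → |δ| < δ₀ →
            ∀ φ : PhaseSpace N → ℝ, Measurable φ →
              μ N (T + δ / 2) (T - δ / 2) =
                ((pinnedChain ω₂ lam β γ).gibbsMeasure N T).withDensity
                  (fun x => ENNReal.ofReal (Real.exp (φ x))) →
              ∀ᵐ x ∂((pinnedChain ω₂ lam β γ).gibbsMeasure N T),
                (pinnedChain ω₂ lam β γ).hamiltonian N x ≤ s * Real.log (1 / |δ|) →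
                  |φ x - φ (x.1, -x.2)| ≤ η

/-! ## 2. A1 ∧ LWS ⟹ SPC -/

/-- **Chebyshev off the window.** For a finite measure `ν` with `∫ e^{θH} dν ≤ C₁` (`θ > 0`) and a
window height `L`: `ν {L < H} ≤ C₁ e^{−θL}` (as a real number). [folklore] -/
theorem measureReal_lt_hamiltonian_le (P : OscillatorChain) (ν : Measure (PhaseSpace N))
    [IsFiniteMeasure ν] {θ C₁ L : ℝ} (hθ : 0 < θ)
    (hI : Integrable (fun x => exp (θ * P.hamiltonian N x)) ν)
    (hC : ∫ x, exp (θ * P.hamiltonian N x) ∂ν ≤ C₁) :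
    ν.real {x | L < P.hamiltonian N x} ≤ C₁ / exp (θ * L) := by
  have hmk := mul_meas_ge_le_integral_of_nonneg (ae_of_all _ fun x => (exp_pos _).le) hI
    (exp (θ * L))
  have hsub : {x | L < P.hamiltonian N x} ⊆ {x | exp (θ * L) ≤ exp (θ * P.hamiltonian N x)} :=
    fun x hx => exp_le_exp.2 (mul_le_mul_of_nonneg_left (le_of_lt hx) hθ.le)
  have hmono : ν.real {x | L < P.hamiltonian N x} ≤
      ν.real {x | exp (θ * L) ≤ exp (θ * P.hamiltonian N x)} := measureReal_mono hsub
  rw [le_div_iff₀ (exp_pos _)]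
  nlinarith [exp_pos (θ * L)]

/-- ★ **A1 ∧ LWS ⟹ SPC.**  Given `η > 0` and an order `s`, take the window slope `s' = (s+1)/θ`
(`θ` from A1).  For `0 < |δ| < δ₀ := min(δ₁, δ_L, 2T, 1/(C₁⁺+1))` and a representation `φ` at `δ`:
`{η < |ψ|} ⊆ {H > s' log(1/|δ|)}` up to a `μ_T`-null (hence `μ_δ`-null) set by LWS, and
`μ_δ(H > s' log(1/|δ|)) ≤ C₁ |δ|^{θ s'} = C₁ |δ| · |δ|ˢ ≤ |δ|ˢ` by A1 and Chebyshev. [folklore] -/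
theorem nessOddLogRatioConcentration_of_windowSmall (h1 : NessExpMomentBound)
    (hL : NessOddLogRatioWindowSmall) : NessOddLogRatioConcentration := by
  intro ω₂ lam β γ hω₂ hlam hβ hγ hU μ hμ T hT N hN η hη s
  obtain ⟨δ₁, θ, C₁, hδ₁, hθ, hA1⟩ := h1 ω₂ lam β γ hω₂ hlam hβ hγ hU μ hμ T hT N hN
  set P := pinnedChain ω₂ lam β γ with hP
  set μT := P.gibbsMeasure N T with hμT
  set s' : ℝ := (s + 1) / θ with hs'
  obtain ⟨δL, hδL, hLW⟩ := hL ω₂ lam β γ hω₂ hlam hβ hγ hU μ hμ T hT N hN η hη s'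
  have hC0 : 0 < max C₁ 0 + 1 := by positivity
  refine ⟨min (min δ₁ δL) (min (2 * T) (1 / (max C₁ 0 + 1))), by positivity, ?_⟩
  intro δ hδ0 hδlt φ hφm hrep
  have hδ1 : |δ| < δ₁ := hδlt.trans_le ((min_le_left _ _).trans (min_le_left _ _))
  have hδL' : |δ| < δL := hδlt.trans_le ((min_le_left _ _).trans (min_le_right _ _))
  have hδT : |δ| < 2 * T := hδlt.trans_le ((min_le_right _ _).trans (min_le_left _ _))
  have hδC : |δ| < 1 / (max C₁ 0 + 1) := hδlt.trans_le ((min_le_right _ _).trans (min_le_right _ _))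
  have hδpos : 0 < |δ| := abs_pos.2 hδ0
  have hTp : 0 < T + δ / 2 ∧ 0 < T - δ / 2 := by
    constructor <;> cases abs_lt.1 hδT <;> linarith
  haveI : IsProbabilityMeasure (μ N (T + δ / 2) (T - δ / 2)) := (hμ N _ _ hTp.1 hTp.2).1
  obtain ⟨hIexp, hC₁⟩ := hA1 δ hδ0 hδ1
  -- the level set sits off the window, up to a null set
  set L : ℝ := s' * Real.log (1 / |δ|) with hLdef
  have hac : μ N (T + δ / 2) (T - δ / 2) ≪ μT := by
    rw [hrep]
    exact withDensity_absolutelyContinuous _ _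
  have hwin : ∀ᵐ x ∂(μ N (T + δ / 2) (T - δ / 2)),
      P.hamiltonian N x ≤ L → |φ x - φ (x.1, -x.2)| ≤ η :=
    hac.ae_le (hLW δ hδ0 hδL' φ hφm hrep)
  have hmono : (μ N (T + δ / 2) (T - δ / 2)) {x | η < |φ x - φ (x.1, -x.2)|} ≤
      (μ N (T + δ / 2) (T - δ / 2)) {x | L < P.hamiltonian N x} := by
    refine measure_mono_ae ?_
    filter_upwards [hwin] with x hx hxA
    have hxA' : η < |φ x - φ (x.1, -x.2)| := hxA
    show L < P.hamiltonian N x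
    by_contra hle
    exact absurd (hx (not_lt.1 hle)) (not_le.2 hxA')
  -- Chebyshev with the exponential moment
  have hcheb := measureReal_lt_hamiltonian_le P (μ N (T + δ / 2) (T - δ / 2)) (L := L) hθ hIexp hC₁
  have hexpL : C₁ / exp (θ * L) = C₁ * (|δ| ^ s * |δ|) := by
    have e1 : θ * L = Real.log |δ| * (-(s + 1)) := by
      rw [hLdef, hs', one_div, Real.log_inv]
      field_simp
    rw [e1, ← Real.rpow_def_of_pos hδpos, Real.rpow_neg hδpos.le, div_inv_eq_mul,
      Real.rpow_add hδpos, Real.rpow_one]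
  have hsmall : C₁ * (|δ| ^ s * |δ|) ≤ |δ| ^ s := by
    have hsp : 0 ≤ |δ| ^ s := Real.rpow_nonneg hδpos.le s
    have hC1 : C₁ * |δ| ≤ 1 := by
      have h1 : max C₁ 0 * |δ| ≤ 1 := by
        have h2 : |δ| * (max C₁ 0 + 1) < 1 := by rwa [lt_div_iff₀ hC0] at hδC
        nlinarith [le_max_right C₁ 0, hδpos]
      nlinarith [le_max_left C₁ 0, hδpos]
    calc C₁ * (|δ| ^ s * |δ|) = (C₁ * |δ|) * |δ| ^ s := by ring
      _ ≤ 1 * |δ| ^ s := mul_le_mul_of_nonneg_right hC1 hsp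
      _ = |δ| ^ s := one_mul _
  have hreal : (μ N (T + δ / 2) (T - δ / 2)).real {x | L < P.hamiltonian N x} ≤ |δ| ^ s := by
    rw [hexpL] at hcheb
    exact hcheb.trans hsmall
  calc (μ N (T + δ / 2) (T - δ / 2)) {x | η < |φ x - φ (x.1, -x.2)|}
      ≤ (μ N (T + δ / 2) (T - δ / 2)) {x | L < P.hamiltonian N x} := hmono
    _ = ENNReal.ofReal ((μ N (T + δ / 2) (T - δ / 2)).real {x | L < P.hamiltonian N x}) := by
        rw [measureReal_def, ENNReal.ofReal_toReal (measure_ne_top _ _)]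
    _ ≤ ENNReal.ofReal (|δ| ^ s) := ENNReal.ofReal_le_ofReal hreal

/-- **LWS ⟹ SPC** with A1 discharged by the tree theorem `nessExpMomentBound_holds`. [folklore] -/
theorem nessOddLogRatioConcentration_of_windowSmall' (hL : NessOddLogRatioWindowSmall) :
    NessOddLogRatioConcentration :=
  nessOddLogRatioConcentration_of_windowSmall nessExpMomentBound_holds hL

/-! ## 3. The ladder-internal junctions -/

/-- ★ **`K_fix ⟸ A0 ∧ A2ₚ ∧ LWS ∧ QMD₀`** (`p > 1`; A1 discharged): the divergence-ladder junction
with both new atoms graded one rung up — the tail atom SPC by window smallness LWS, the second-order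
atom ΔSharp by differentiability in quadratic mean QMD₀. [folklore] -/
theorem snapshotKLUpperExpansion_of_ladder {p : ℝ} (hp : 1 < p) (h0 : NessGibbsReweighting)
    (h2 : NessOddLogRatioMoment p) (hL : NessOddLogRatioWindowSmall) (hQ : NessSqrtResponseL2) :
    SnapshotKLUpperExpansion :=
  snapshotKLUpperExpansion_of_triangular hp h0 h2 (nessOddLogRatioConcentration_of_windowSmall' hL)
    (nessFlipTriangularSharp_of_sqrtResponseL2 h0 hQ)

/-- **`K_fix ⟸ A0 ∧ A2ₚ ∧ LWS ∧ A4`** (`p > 1`; A1 discharged): the same with the record's response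
atom A4 (`nessFlipTriangularSharp_of_linearResponseL2`). [folklore] -/
theorem snapshotKLUpperExpansion_of_ladder₄ {p : ℝ} (hp : 1 < p) (h0 : NessGibbsReweighting)
    (h2 : NessOddLogRatioMoment p) (hL : NessOddLogRatioWindowSmall) (h4 : NessLinearResponseL2) :
    SnapshotKLUpperExpansion :=
  snapshotKLUpperExpansion_of_ladder hp h0 h2 hL (nessSqrtResponseL2_of_linearResponseL2 h4)

end Summit.AtomisticToContinuum.FouriersLaw.Theorems.ExtensiveSnapshotIrreversibility.EnergyWindow

end
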